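import Summits.AtomisticToContinuum.FouriersLaw.Theorems.OddSectorIrreversibilityCorrectorTheoryBondSum
import Summits.AtomisticToContinuum.FouriersLaw.Theorems.OddSectorIrreversibilityOddDensityIsCorrectorDensity
import Literature.MathematicalPhysics.KineticTheory.PhaseSpacePoisson
import Literature.MathematicalPhysics.KineticTheory.LangevinSemigroup

/-!
# `HiddenChargeMazur.StaticKubo`, line `birth`: `stub_gradientBound` reduces to ONE witness

Helper file (`--supports stmt-AtomisticToContinuum-13510`, crux decl `HiddenChargeMazur.StaticKubo`,
skeleton `Cruxes/StaticKubo/Lines/birth.lean`, rev 4; written by the rev-3 lead's stub worker as the crux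
workfile `Lines/birth_gradientBound_reduction.lean`, landed unchanged by the continuation lead because the
rev-4 stub `stub_transfer` consumes `stub_gradientBound_of_witness`).  The registered rev-3 stub —

  every `F ∈ C²` with `|F| ≤ C e^{θH}` (`θ < 1/(2T)`) and `L_{T,T} F = -J` pointwise has
  `|F| + |∂_{p_i}F| + |∂_{q_i}F| ≤ C' e^{θ'H}` for some `θ' < 1/(2T)` —

is NOT proved here: it is the weighted `C¹` estimate for the hypoelliptic Langevin-chain Poisson problem,
which rev 4 of the skeleton attacks by coupling + high-energy dissipation + local smoothing.

What IS proved here (sorry-free), making the stub EQUIVALENT to that estimate for ONE solution: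

* `eq_const_of_generator_eq_zero` — **bracket propagation** (pure calculus): for the pinned chain
  (`β ≥ 0`, any `γ, T_L, T_R`), a `C²` function `w` with `L w = 0` pointwise and
  `∂_{p_b} w = 0` at both bath sites is constant.  (`Dw·Y = 0` for the drift `Y`; differentiating
  `Dw·e ≡ 0` along `Y` and using the symmetry of `D²w` gives `Dw·(DY e) = 0`; `DY(∂_{p_k}) = ∂_{q_k}
  - γ1_B ∂_{p_k}`, `DY(∂_{q_k}) = -∑_i Φ_{ik} ∂_{p_i}` with `Φ_{k+1,k} = -V'' ≤ -1`: peel site by site.)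
* `exists_const_of_valueClass` — **uniqueness up to constants of value-class `C²` solutions** of
  `L_{T,T} F = -k` (`ω₂, γ, T > 0`, `lam, β ≥ 0`): the tap energy identity of the tree
  (`Corrector.integral_mul_source_eq_dirichlet`) applied to the difference `w` (source `0`) gives
  `∂_{p_b} w = 0` a.e., hence everywhere, and bracket propagation makes `w` constant.
* `stub_gradientBound_of_witness` — hence the stub follows from the full growth bound for ANY ONE
  `C²` solution of `L_{T,T} F₀ = -J` (e.g. the smooth Kubo corrector `u = ∫₀^∞ P_t J dt` of
  `Corrector.corrector_smooth`): the stub is exactly "`|∇u| ≤ C e^{θ'H}`, `θ' < 1/(2T)`".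

The single missing estimate (NOT assumed anywhere in this file; recorded for the lead).  Either of
the following closes the stub through `stub_gradientBound_of_witness` with `F₀ = u`:

* (HE-loc, PDE form — Hörmander made quantitative, constants polynomial in the centre; the `C¹`
  upgrade of Eckmann–Hairer 2003 Thm 3.1, which prints only the `H^{ε_*}`/`L²` version):
  `∀ ω₂ lam β γ T > 0, ∀ N ≥ 1, ∃ C M, ∀ x (F ∈ C²), (∀ z ∈ closedBall x 1, L_{T,T} F z = -J z) →
     ∀ i, |∂_{p_i}F x| + |∂_{q_i}F x| ≤ C (1+‖x‖)^M (1 + sup_{closedBall x 1} |F|)`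
  (then `|∇u| ≤ C' e^{θ'H}` for EVERY `θ' > 0`, since `|u| ≤ K_ϑ e^{ϑH}` for every `ϑ > 0` and
  `sup_{B(x,1)} H ≤ H(x) + c(1+H(x))^{3/4}`);
* (S)+(J), probabilistic form (idea card `unit-window-bismut-borrowed-decay`): the unit-time weighted
  Bismut bound `|∇(P_1ψ)(x)| ≤ C e^{ϑ'H(x)} ‖ψe^{-ϑH}‖_∞` for measurable `ψ` plus unit-window
  tangent moments `E‖Dz_t(x)‖² ≤ C e^{εH(x)}`, `t ≤ 1` (`u = ∫₀¹P_tJ + P_1u`).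
Printed coverage: Wang–Zhang 2013 Thm 4.1/4.2 and Guillin–Wang 2012 need the degenerate component
to be reached in ONE bracket (chain length `N = 2`) or to evolve linearly (harmonic chain);
Menegaki 2020 Prop. 3.6 (`Γ(P_tf) ≤ e^{-2λt}(P_t√Γf)²`) needs bounded Hessians (quartic excluded);
Hairer–Majda 2010 §3: no general control of the gradient weight.  Nothing covers `N ≥ 3`.

References: Eckmann–Pillet–Rey-Bellet 1999 §3 (controllability cascade `V'' ≠ 0`);
Cuneo–Eckmann–Hairer–Rey-Bellet 2018 Prop. 4.1; Eckmann–Hairer 2003 Thm 3.1; folklore.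
-/

noncomputable section

open MeasureTheory Filter Topology
open scoped ContDiff
open Literature.MathematicalPhysics.KineticTheory.HeatConduction
open Summit.AtomisticToContinuum.FouriersLaw.Theorems.OddSectorIrreversibility
open Summit.AtomisticToContinuum.FouriersLaw.Theorems.OddSectorIrreversibility.Corrector
open Summit.AtomisticToContinuum.FouriersLaw.Theorems.SuperadditiveResistance.Kubo

namespace Summit.AtomisticToContinuum.FouriersLaw.Cruxes.StaticKubo.Birth.Stubs

variable {N : ℕ}

/-! ### 1. Two calculus facts on `C²` functions -/

/-- If `Dw · e ≡ 0` for a fixed direction `e` (`w ∈ C²`), then `D²w(x)(v, e) = 0`. [folklore] -/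
theorem fderiv_fderiv_apply_eq_zero_of_forall {w : PhaseSpace N → ℝ} (hw : ContDiff ℝ 2 w)
    {e : PhaseSpace N} (he : ∀ x, fderiv ℝ w x e = 0) (x v : PhaseSpace N) :
    fderiv ℝ (fderiv ℝ w) x v e = 0 := by
  have h := hasFDerivAt_fderiv_apply hw x e
  have h0 : (fun y => fderiv ℝ w y e) = fun _ => (0 : ℝ) := funext he
  rw [h0] at h
  have hu := (hasFDerivAt_const (0 : ℝ) x).unique h
  have := congrArg (fun L : PhaseSpace N →L[ℝ] ℝ => L v) hu
  simp only [zero_apply, ContinuousLinearMap.flip_apply] at this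
  exact this.symm

/-- If `Dw(x) · Y(x) ≡ 0` along a differentiable vector field `Y` and `Dw · e ≡ 0` for a fixed
direction `e` (`w ∈ C²`), then `Dw(x) · (DY(x) e) = 0` — the function-level shadow of the Lie
bracket `[e, Y]`. [folklore] -/
theorem fderiv_apply_fderiv_field_eq_zero {w : PhaseSpace N → ℝ} (hw : ContDiff ℝ 2 w)
    {Y : PhaseSpace N → PhaseSpace N} (hY : Differentiable ℝ Y)
    (hker : ∀ x, fderiv ℝ w x (Y x) = 0) {e : PhaseSpace N} (he : ∀ x, fderiv ℝ w x e = 0)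
    (x : PhaseSpace N) : fderiv ℝ w x (fderiv ℝ Y x e) = 0 := by
  have hd : HasFDerivAt (fderiv ℝ w) (fderiv ℝ (fderiv ℝ w) x) x :=
    (((hw.fderiv_right (m := 1) (by norm_num)).differentiable one_ne_zero) x).hasFDerivAt
  have h := hd.clm_apply (hY x).hasFDerivAt
  have h0 : (fun y => fderiv ℝ w y (Y y)) = fun _ => (0 : ℝ) := funext hker
  rw [h0] at h
  have hu := (hasFDerivAt_const (0 : ℝ) x).unique h
  have := congrArg (fun L : PhaseSpace N →L[ℝ] ℝ => L e) hu
  simp only [zero_apply, add_apply, ContinuousLinearMap.coe_comp, Function.comp_apply,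
    ContinuousLinearMap.flip_apply] at this
  rw [fderiv_fderiv_symm hw x e (Y x), fderiv_fderiv_apply_eq_zero_of_forall hw he x (Y x),
    add_zero] at this
  exact this.symm

/-! ### 2. Bracket propagation along the chain -/

section Bracket

variable {ω₂ lam β γ : ℝ} (hβ : 0 ≤ β)
include hβ

/-- **Bracket propagation.** For the pinned chain (`β ≥ 0`, so `V'' = 1 + 3βr² ≥ 1`), a `C²`
function `w` with `L_{T_L,T_R} w = 0` pointwise whose momentum derivatives vanish at both bath
sites is constant: `∂_{p_k} w ≡ 0 ⇒ ∂_{q_k} w ≡ 0` (bracket with the drift) and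
`∂_{q_k} w ≡ 0 ⇒ V''(q_{k+1}-q_k) ∂_{p_{k+1}} w ≡ 0` (next bracket), peeled from site `0`.
[folklore] -/
theorem eq_const_of_generator_eq_zero (T_L T_R : ℝ) {w : PhaseSpace N → ℝ} (hw : ContDiff ℝ 2 w)
    (hL : ∀ x, (pinnedChain ω₂ lam β γ).generator N T_L T_R w x = 0)
    (hbath : ∀ i : Fin N, (i.val = 0 ∨ i.val = N - 1) → ∀ x, partialP i w x = 0)
    (x y : PhaseSpace N) : w x = w y := by
  set P := pinnedChain ω₂ lam β γ with hP
  have hU : ContDiff ℝ ∞ P.U := pinnedChain_contDiff_U ω₂ lam β γ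
  have hV : ContDiff ℝ ∞ P.V := pinnedChain_contDiff_V ω₂ lam β γ
  have hwd : Differentiable ℝ w := hw.differentiable two_ne_zero
  have hYd : Differentiable ℝ (P.drift N) := (P.contDiff_drift hU hV N).differentiable (by simp)
  -- the momentum derivatives at the baths, in Fréchet form
  have hbathF : ∀ i : Fin N, (i.val = 0 ∨ i.val = N - 1) → ∀ z, fderiv ℝ w z (unitP i) = 0 := by
    intro i hi z
    have := hbath i hi z
    rw [partialP_eq_fderiv hwd] at this
    simpa [unitP] using this
  -- `Dw · Y = 0`: the second-order part of `L w` vanishes with `∂_{p_b} w`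
  have hker : ∀ z, fderiv ℝ w z (P.drift N z) = 0 := by
    intro z
    have h := P.generator_eq_fderiv_drift_add N T_L T_R hwd z
    have hsum : ∑ i : Fin N, ((if i.val = 0 then T_L else 0) + (if i.val = N - 1 then T_R else 0)) *
        partialP i (partialP i w) z = 0 := by
      refine Finset.sum_eq_zero fun i _ => ?_
      by_cases hi : i.val = 0 ∨ i.val = N - 1
      · have : partialP i w = fun _ => 0 := funext (hbath i hi)
        rw [this]
        simp [partialP]
      · simp only [not_or] at hi
        simp [hi.1, hi.2]
    rw [hL z, hsum, mul_zero, add_zero] at h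
    exact h.symm
  -- the two brackets with the drift
  have e1 : ∀ (z : PhaseSpace N) (k : Fin N), fderiv ℝ (P.drift N) z (unitP k) =
      unitQ k + (-(P.γ * OscillatorChain.bathWeight N k)) • unitP k := by
    intro z k
    rw [P.fderiv_drift_apply hU hV N z (unitP k)]
    refine Prod.ext ?_ (funext fun i => ?_)
    · simp [unitP, unitQ]
    · by_cases hik : i = k
      · subst hik
        simp [unitP, unitQ]
      · simp [unitP, unitQ, hik]
  have e2 : ∀ (z : PhaseSpace N) (k : Fin N), fderiv ℝ (P.drift N) z (unitQ k) =
      ∑ i, (-(P.hessPotential N i k z.1)) • unitP i := by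
    intro z k
    rw [P.fderiv_drift_apply hU hV N z (unitQ k)]
    refine Prod.ext ?_ (funext fun i => ?_)
    · simp [unitP, unitQ, Prod.fst_sum]
    · simp [unitP, unitQ, Prod.snd_sum, Finset.sum_apply, Pi.single_apply]
  -- step `∂_{p_k} w ≡ 0 ⇒ ∂_{q_k} w ≡ 0`
  have hPQ : ∀ k : Fin N, (∀ z, fderiv ℝ w z (unitP k) = 0) → ∀ z, fderiv ℝ w z (unitQ k) = 0 := by
    intro k hk z
    have h := fderiv_apply_fderiv_field_eq_zero hw hYd hker hk z
    rw [e1 z k, map_add, map_smul, hk z, smul_zero, add_zero] at h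
    exact h
  -- peeling: all momentum derivatives vanish
  have hPn : ∀ n : ℕ, ∀ k : Fin N, k.val ≤ n → ∀ z, fderiv ℝ w z (unitP k) = 0 := by
    intro n
    induction n with
    | zero =>
        intro k hk z
        exact hbathF k (Or.inl (by omega)) z
    | succ n ih =>
        intro k hk z
        rcases Nat.lt_or_ge k.val (n + 1) with hlt | hge
        · exact ih k (by omega) z
        · have hkv : k.val = n + 1 := le_antisymm hk hge
          have hn : n < N := by omega
          set k' : Fin N := ⟨n, hn⟩ with hk'
          have hQ' : ∀ y, fderiv ℝ w y (unitQ k') = 0 := hPQ k' (fun y => ih k' le_rfl y)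
          have h := fderiv_apply_fderiv_field_eq_zero hw hYd hker hQ' z
          rw [e2 z k', map_sum] at h
          simp only [map_smul, smul_eq_mul] at h
          rw [Finset.sum_eq_single k] at h
          · have hne : P.hessPotential N k k' z.1 ≠ 0 := by
              rw [P.hessPotential_succ N (show k.val = k'.val + 1 by simp [k', hkv]) z.1,
                pinnedChain_deriv_deriv_V]
              have : 0 < 1 + 3 * β * (z.1 k - z.1 k') ^ 2 := by positivity
              linarith
            rcases mul_eq_zero.1 h with h1 | h1
            · exact absurd (neg_eq_zero.1 h1) hne
            · exact h1
          · intro i _ hik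
            rcases Nat.lt_or_ge i.val (n + 1) with hi | hi
            · rw [ih i (by omega) z, mul_zero]
            · have hi2 : k'.val + 2 ≤ i.val := by
                have : i.val ≠ n + 1 := fun e => hik (Fin.ext (by rw [e, hkv]))
                simp only [k']
                omega
              rw [P.hessPotential_eq_zero_of_le N hi2, neg_zero, zero_mul]
          · intro hk
            exact absurd (Finset.mem_univ k) hk
  have hPall : ∀ (k : Fin N) (z : PhaseSpace N), fderiv ℝ w z (unitP k) = 0 :=
    fun k z => hPn k.val k le_rfl z
  have hQall : ∀ (k : Fin N) (z : PhaseSpace N), fderiv ℝ w z (unitQ k) = 0 :=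
    fun k => hPQ k (hPall k)
  have hzero : ∀ z, fderiv ℝ w z = 0 := fun z => ContinuousLinearMap.ext fun v => by
    rw [clm_apply_eq_sum (fderiv ℝ w z) v]
    simp [hPall, hQall]
  exact is_const_of_fderiv_eq_zero hwd hzero x y

end Bracket

/-! ### 3. Uniqueness up to constants of value-class solutions of the Poisson equation -/

section Pinned

variable {ω₂ lam β γ : ℝ} (hω : 0 < ω₂) (hl : 0 ≤ lam) (hβ : 0 ≤ β) (hγ : 0 < γ) {T : ℝ} (hT : 0 < T)
include hω hl hβ hγ hT

omit hγ in
/-- Value-class observables are in `L²(μ_T)`: `|F| ≤ C e^{θH}` with `θ < 1/(2T)`. [folklore] -/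
theorem memLp_two_of_valueClass {F : PhaseSpace N → ℝ} (hF : Continuous F)
    (hb : ∃ C θ : ℝ, θ < 1 / (2 * T) ∧
      ∀ z, |F z| ≤ C * Real.exp (θ * (pinnedChain ω₂ lam β γ).hamiltonian N z)) :
    MemLp F 2 ((pinnedChain ω₂ lam β γ).gibbsMeasure N T) := by
  obtain ⟨C, θ, hθ, hb⟩ := hb
  have hT2 : (0 : ℝ) < 2 * T := by positivity
  have h1 : θ * (2 * T) < 1 := (lt_div_iff₀ hT2).1 hθ
  have h2θ : 2 * θ < 1 / T := by
    rw [lt_div_iff₀ hT]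
    nlinarith
  exact memLp_two_of_abs_le_exp hω hl hβ hT γ hF h2θ hb

/-- **Value-class `C²` solutions of `L_{T,T} F = -k` are unique up to additive constants.**
For the pinned chain (`ω₂, γ, T > 0`, `lam, β ≥ 0`): if `F₁, F₂ ∈ C²` both satisfy
`|F_j| ≤ C_j e^{θ_j H}` with `θ_j < 1/(2T)` and solve `L_{T,T} F_j = -k` pointwise (same `k`), then
`F₁ = F₂ + c`.  Proof: `w = F₁ - F₂ ∈ C² ∩ L²(μ_T)` solves `L w = 0`; the tap energy identity with
source `0` (`Corrector.integral_mul_source_eq_dirichlet`) gives `∫ (∂_{p_b} w)² e^{-H/T} = 0` at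
both baths, so `∂_{p_b} w = 0` everywhere (continuity), and bracket propagation
(`eq_const_of_generator_eq_zero`) makes `w` constant. [folklore] -/
theorem exists_const_of_valueClass {F₁ F₂ k : PhaseSpace N → ℝ} (hF₁ : ContDiff ℝ 2 F₁)
    (hF₂ : ContDiff ℝ 2 F₂)
    (hb₁ : ∃ C θ : ℝ, θ < 1 / (2 * T) ∧
      ∀ z, |F₁ z| ≤ C * Real.exp (θ * (pinnedChain ω₂ lam β γ).hamiltonian N z))
    (hb₂ : ∃ C θ : ℝ, θ < 1 / (2 * T) ∧
      ∀ z, |F₂ z| ≤ C * Real.exp (θ * (pinnedChain ω₂ lam β γ).hamiltonian N z))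
    (hL₁ : ∀ z, (pinnedChain ω₂ lam β γ).generator N T T F₁ z = -k z)
    (hL₂ : ∀ z, (pinnedChain ω₂ lam β γ).generator N T T F₂ z = -k z) :
    ∃ c : ℝ, ∀ z, F₁ z = F₂ z + c := by
  set P := pinnedChain ω₂ lam β γ with hP
  have hUc : Continuous P.U := (pinnedChain_contDiff_U ω₂ lam β γ (n := ∞)).continuous
  have hVc : Continuous P.V := (pinnedChain_contDiff_V ω₂ lam β γ (n := ∞)).continuous
  haveI : IsProbabilityMeasure (P.gibbsMeasure N T) :=
    pinnedChain_isProbabilityMeasure_gibbsMeasure hω hl hβ γ N hT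
  set w : PhaseSpace N → ℝ := fun z => F₁ z - F₂ z with hw_def
  have hw : ContDiff ℝ 2 w := hF₁.sub hF₂
  -- `L w = 0`
  have hLw : ∀ z, P.generator N T T w z = 0 := fun z => by
    have e : w = fun y => F₁ y + (-1) * F₂ y := by
      funext y
      simp only [hw_def]
      ring
    rw [e, generator_add P N T T hF₁ (contDiff_const.mul hF₂) z,
      generator_const_mul P N T T (-1) F₂ z, hL₁ z, hL₂ z]
    ring
  have hLw' : ∀ z, P.generator N T T w z = -(fun _ : PhaseSpace N => (0 : ℝ)) z := fun z => by
    rw [hLw z]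
    simp
  -- `w ∈ L²(μ_T)`, zero source
  have hw2 : MemLp w 2 (P.gibbsMeasure N T) :=
    (memLp_two_of_valueClass hω hl hβ hT hF₁.continuous hb₁).sub
      (memLp_two_of_valueClass hω hl hβ hT hF₂.continuous hb₂)
  have hk0 : MemLp (fun _ : PhaseSpace N => (0 : ℝ)) 2 (P.gibbsMeasure N T) := memLp_const 0
  -- the tap energy identity with zero source
  have htap := integral_mul_source_eq_dirichlet hω hl hβ hγ hT hw hw2 continuous_const hk0 hLw'
  have hsum : ∑ i : Fin N, OscillatorChain.bathWeight N i *
      ∫ x, partialP i w x ^ 2 * P.gibbsDensity N T x = 0 := by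
    have h1 : ∫ x, w x * (fun _ : PhaseSpace N => (0 : ℝ)) x * P.gibbsDensity N T x = (0 : ℝ) := by
      simp
    rw [h1] at htap
    have hγT : γ * T ≠ 0 := by positivity
    rcases mul_eq_zero.1 htap.symm with h | h
    · exact absurd h hγT
    · exact h
  have hI0 : ∀ i : Fin N, 0 < OscillatorChain.bathWeight N i →
      ∫ x, partialP i w x ^ 2 * P.gibbsDensity N T x = 0 := by
    intro i hi
    have hnn : ∀ j ∈ (Finset.univ : Finset (Fin N)),
        0 ≤ OscillatorChain.bathWeight N j * ∫ x, partialP j w x ^ 2 * P.gibbsDensity N T x :=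
      fun j _ => mul_nonneg (Corrector.bathWeight_nonneg N j)
        (integral_nonneg fun x => mul_nonneg (sq_nonneg _) (P.gibbsDensity_pos N T x).le)
    have := (Finset.sum_eq_zero_iff_of_nonneg hnn).1 hsum i (Finset.mem_univ i)
    rcases mul_eq_zero.1 this with h | h
    · exact absurd h hi.ne'
    · exact h
  -- `∂_{p_b} w = 0` everywhere at the bath sites
  have hbath : ∀ i : Fin N, (i.val = 0 ∨ i.val = N - 1) → ∀ x, partialP i w x = 0 := by
    intro i hi
    have hBi : 0 < OscillatorChain.bathWeight N i := by
      unfold OscillatorChain.bathWeight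
      rcases hi with h | h
      · rw [if_pos h]
        have : 0 ≤ (if i.val = N - 1 then (1 : ℝ) else 0) := by split_ifs <;> norm_num
        linarith
      · rw [if_pos h]
        have : 0 ≤ (if i.val = 0 then (1 : ℝ) else 0) := by split_ifs <;> norm_num
        linarith
    have hint : Integrable (fun x => partialP i w x ^ 2 * P.gibbsDensity N T x) :=
      integrable_sq_mul_gibbsDensity hω hl hβ γ N hT
        (memLp_partialP_of_poisson hω hl hβ hγ hT hw hw2 hk0 hLw' hBi)
    have hae := (integral_eq_zero_iff_of_nonneg
      (fun x => mul_nonneg (sq_nonneg _) (P.gibbsDensity_pos N T x).le) hint).1 (hI0 i hBi)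
    have hcont : Continuous fun x => partialP i w x ^ 2 * P.gibbsDensity N T x :=
      ((continuous_partialP hw two_ne_zero i).pow 2).mul (P.continuous_gibbsDensity hUc hVc N T)
    have heq := (hcont.ae_eq_iff_eq volume continuous_zero).1 hae
    intro x
    have hx := congrFun heq x
    simp only [Pi.zero_apply, mul_eq_zero, (P.gibbsDensity_pos N T x).ne', or_false,
      pow_eq_zero_iff, ne_eq, OfNat.ofNat_ne_zero, not_false_eq_true] at hx
    exact hx
  -- bracket propagation
  have hconst := eq_const_of_generator_eq_zero hβ T T hw hLw hbath
  refine ⟨w (0 : PhaseSpace N), fun z => ?_⟩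
  have := hconst z 0
  simp only [hw_def] at this ⊢
  linarith

end Pinned

/-! ### 4. The stub reduces to the growth bound for ONE solution (e.g. the Kubo corrector) -/

/-- `∂_{p_i}` ignores additive constants. [folklore] -/
theorem partialP_add_const (i : Fin N) (F : PhaseSpace N → ℝ) (c : ℝ) (z : PhaseSpace N) :
    partialP i (fun y => F y + c) z = partialP i F z := by
  simp [partialP]

/-- `∂_{q_i}` ignores additive constants. [folklore] -/
theorem partialQ_add_const (i : Fin N) (F : PhaseSpace N → ℝ) (c : ℝ) (z : PhaseSpace N) :
    partialQ i (fun y => F y + c) z = partialQ i F z := by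
  simp [partialQ]

/-- **Reduction of `stub_gradientBound` to a single witness.** If for every admissible parameter
point there is ONE `C²` solution `F₀` of `L_{T,T} F₀ = -J` with the full growth bound
`|F₀| + |∂_{p_i}F₀| + |∂_{q_i}F₀| ≤ C e^{θH}`, `θ < 1/(2T)` (the natural candidate being the smooth
Kubo corrector `u = ∫₀^∞ P_t J dt` of `Corrector.corrector_smooth`), then the registered stub
`stub_gradientBound` holds: every value-class `C²` solution is `F₀ + c`
(`exists_const_of_valueClass`), and constants are absorbed with `θ' = max θ 0` (`H ≥ 0`).
So the stub is EQUIVALENT to the weighted gradient bound for the corrector. [folklore] -/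
theorem stub_gradientBound_of_witness :
    (∀ ω₂ lam β γ : ℝ, 0 < ω₂ → 0 < lam → 0 < β → 0 < γ → ∀ T : ℝ, 0 < T → ∀ N : ℕ, 2 ≤ N → ∃ F₀ : PhaseSpace N → ℝ, ContDiff ℝ 2 F₀ ∧ (∀ z, (pinnedChain ω₂ lam β γ).generator N T T F₀ z = -(∑ i : Fin N, (pinnedChain ω₂ lam β γ).bondCurrent N i z)) ∧ ∃ C θ : ℝ, θ < 1 / (2 * T) ∧ ∀ (z : PhaseSpace N) (i : Fin N), |F₀ z| + |partialP i F₀ z| + |partialQ i F₀ z| ≤ C * Real.exp (θ * (pinnedChain ω₂ lam β γ).hamiltonian N z)) → ∀ ω₂ lam β γ : ℝ, 0 < ω₂ → 0 < lam → 0 < β → 0 < γ → ∀ P : Literature.MathematicalPhysics.KineticTheory.HeatConduction.OscillatorChain, P = Literature.MathematicalPhysics.KineticTheory.HeatConduction.pinnedChain ω₂ lam β γ → ∀ T : ℝ, 0 < T → ∀ N : ℕ, 2 ≤ N → ∀ F : Literature.MathematicalPhysics.KineticTheory.HeatConduction.PhaseSpace N → ℝ, ContDiff ℝ 2 F → (∃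 C θ : ℝ, θ < 1 / (2 * T) ∧ ∀ z : Literature.MathematicalPhysics.KineticTheory.HeatConduction.PhaseSpace N, |F z| ≤ C * Real.exp (θ * P.hamiltonian N z)) → (∀ z : Literature.MathematicalPhysics.KineticTheory.HeatConduction.PhaseSpace N, P.generator N T T F z = -(∑ i : Fin N, P.bondCurrent N i z)) → ∃ C θ : ℝ, θ < 1 / (2 * T) ∧ ∀ (z : Literature.MathematicalPhysics.KineticTheory.HeatConduction.PhaseSpace N) (i : Fin N), |F z| + |Literature.MathematicalPhysics.KineticTheory.HeatConduction.partialP i F z| + |Literature.MathematicalPhysics.KineticTheory.HeatConduction.partialQ i F z| ≤ C * Real.exp (θ * P.hamiltonian N z) := by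
  intro hW ω₂ lam β γ hω hl hβ hγ P hP T hT N hN F hF hFv hFL
  subst hP
  obtain ⟨F₀, hF₀, hL₀, C, θ, hθ, hb⟩ := hW ω₂ lam β γ hω hl hβ hγ T hT N hN
  set H := (pinnedChain ω₂ lam β γ).hamiltonian N with hH
  have i₀ : Fin N := ⟨0, by omega⟩
  have hb₀ : ∃ C θ : ℝ, θ < 1 / (2 * T) ∧ ∀ z, |F₀ z| ≤ C * Real.exp (θ * H z) :=
    ⟨C, θ, hθ, fun z => by
      have := hb z i₀
      linarith [abs_nonneg (partialP i₀ F₀ z), abs_nonneg (partialQ i₀ F₀ z)]⟩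
  obtain ⟨c, hc⟩ := exists_const_of_valueClass hω hl.le hβ.le hγ hT hF hF₀ hFv hb₀ hFL hL₀
  have hFeq : F = fun z => F₀ z + c := funext hc
  refine ⟨max C 0 + |c|, max θ 0, max_lt hθ (by positivity), fun z i => ?_⟩
  rw [hFeq, partialP_add_const, partialQ_add_const]
  have hHz : 0 ≤ H z := pinnedChain_hamiltonian_nonneg hω.le hl.le hβ.le γ N z
  have he1 : Real.exp (θ * H z) ≤ Real.exp (max θ 0 * H z) :=
    Real.exp_le_exp.2 (mul_le_mul_of_nonneg_right (le_max_left _ _) hHz)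
  have he2 : 1 ≤ Real.exp (max θ 0 * H z) := Real.one_le_exp (mul_nonneg (le_max_right _ _) hHz)
  have hC : C * Real.exp (θ * H z) ≤ max C 0 * Real.exp (max θ 0 * H z) :=
    (mul_le_mul_of_nonneg_right (le_max_left C 0) (Real.exp_pos _).le).trans
      (mul_le_mul_of_nonneg_left he1 (le_max_right _ _))
  calc |F₀ z + c| + |partialP i F₀ z| + |partialQ i F₀ z|
      ≤ |F₀ z| + |partialP i F₀ z| + |partialQ i F₀ z| + |c| := by
        linarith [abs_add_le (F₀ z) c]
    _ ≤ C * Real.exp (θ * H z) + |c| := by linarith [hb z i]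
    _ ≤ max C 0 * Real.exp (max θ 0 * H z) + |c| * Real.exp (max θ 0 * H z) :=
        add_le_add hC (le_mul_of_one_le_right (abs_nonneg c) he2)
    _ = (max C 0 + |c|) * Real.exp (max θ 0 * H z) := by ring

end Summit.AtomisticToContinuum.FouriersLaw.Cruxes.StaticKubo.Birth.Stubs

end
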